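import Summits.RiemannHypothesis.RiemannHypothesis.Theorems.NymanBeurlingDilateZeroSumIntegral
import Summits.RiemannHypothesis.RiemannHypothesis.Theorems.NymanBeurlingDilateZeroSumTrivialPart
import Summits.RiemannHypothesis.RiemannHypothesis.Theorems.NymanBeurlingDilateZeroSumPrimePart
import Summits.RiemannHypothesis.RiemannHypothesis.Theorems.NymanBeurlingDilateZeroSumOne
import HarnessLib

/-!
# RiemannHypothesis / Nyman–Beurling — THE DILATE ZERO SUMS ARE PRIME SUMS: `S(n) = nbDilatePrimeSide n` (`n ≥ 2`)
# — theory target (T7) `NbDilateZeroSumExplicit`, RH-FREE, DISCHARGED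

Column LI/NB of the RH ladder, rung L-P(P2) «structure of the NB minimiser», PROOF-OF-DATA for cell `pub/rh-li`
[rh-li-eng-3 g5].  Assembly of steps I–IV (`NymanBeurlingDilateZeroSum{Integral,PClosedForm,TrivialPart,PrimePart}.lean`):

* `phi_eq_real` — the EXACT EXPLICIT FORMULA for the weighted zero sum, every real `x ≥ 1`:
  `Σ_ρ m_ρ x^ρ/(ρ(1−ρ)) = (1+γ)x − x log x − log 2π + Σ_{n≤x} Λ(n)(x/n − 1) + Σ_{k≥1} x^{−2k}/(2k(2k+1))`
  (i.e. the Riesz-type mean `Σ_{n≤x} Λ(n)(x/n − 1) = x Σ_{n≤x}Λ(n)/n − ψ(x)` has the exact explicit formula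
  `x log x − (1+γ)x + log 2π + Σ_ρ m_ρ x^ρ/(ρ(1−ρ)) − Σ_{k≥1} x^{−2k}/(2k(2k+1))`);
* `nbDilateZeroSum_eq_nbDilatePrimeSide` — for every integer `n ≥ 2`,
  `S(n) = Σ_ρ m_ρ n^{−ρ}/(ρ(1−ρ)) = (Σ_{m≤n} Λ(m)/m − log n + γ) − (ψ(n) − n)/n + (1 − log 2π)/n − (1/2n) log(1 − n⁻²)
  − ½ log((n+1)/(n−1)) = nbDilatePrimeSide n`;
* `nbDilateZeroSumExplicit_holds` — both conjuncts of the theory target T7 (`theory/NBHeadTail.lean`), with g4's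
  `nbDilateZeroSum_one` (`S(1) = 2 + γ − log 4π`).

Consequently the predicted limit `κ_∞ = nbKappaPredicted` of the NB minimiser's κ-law (theory (L5′)) is a PRIME-SIDE number with
no reference to zeros.  Each bracket of `nbDilatePrimeSide n` tends to `0` (Mertens / PNT), so `S(n) → 0`.
RH-FREE [rh-li-eng-3 g5]: an unconditional explicit formula (de la Vallée Poussin 1896 for `ψ₁`, integrated once more); nothing
here bears on `d_N → 0` or on the truth of RH.
-/

noncomputable section

set_option linter.dupNamespace false

open Filter Set MeasureTheory Topology intervalIntegral
open scoped Real

namespace Summit.RiemannHypothesis.RiemannHypothesis.Theorems.NbTheory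

open Literature.NumberTheory.LFunctions

namespace DilateExplicit

/-- `R(t)/t³` is continuous on `[1, x]`, `R(t) = t²/2 − t log 2π − T(t) − ψ₁(t)`. -/
lemma continuousOn_rDiv (x : ℝ) :
    ContinuousOn (fun t : ℝ ↦ (t ^ 2 / 2 - t * Real.log (2 * π) -
      (∑' k : ℕ, t ^ (-(2 * (k : ℝ) + 1)) / ((2 * k + 2) * (2 * k + 1))) - psiOne t) / t ^ 3) (Set.Icc 1 x) := by
  have hT := continuousOn_trivSum.mono (fun t (ht : t ∈ Set.Icc (1 : ℝ) x) ↦ Set.mem_Ici.2 ht.1)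
  have hP := (continuousOn_psiOne x).mono (fun t (ht : t ∈ Set.Icc (1 : ℝ) x) ↦ ⟨zero_le_one.trans ht.1, ht.2⟩)
  refine ContinuousOn.div (((by fun_prop : ContinuousOn (fun t : ℝ ↦ t ^ 2 / 2 - t * Real.log (2 * π))
    (Set.Icc 1 x)).sub hT).sub hP) (by fun_prop) fun t ht ↦ ?_
  have : 0 < t := by linarith [ht.1]
  positivity

/-- The real integral `∫_1^x R(t) t⁻³ dt = (log x)/2 − log 2π (1 − 1/x) − ∫_1^x T t⁻³ − ∫_1^x ψ₁ t⁻³`. -/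
lemma integral_rDiv {x : ℝ} (hx : 1 ≤ x) :
    ∫ t in (1 : ℝ)..x, (t ^ 2 / 2 - t * Real.log (2 * π) -
        (∑' k : ℕ, t ^ (-(2 * (k : ℝ) + 1)) / ((2 * k + 2) * (2 * k + 1))) - psiOne t) / t ^ 3 =
      Real.log x / 2 - Real.log (2 * π) * (1 - 1 / x) -
        (∫ t in (1 : ℝ)..x, (∑' k : ℕ, t ^ (-(2 * (k : ℝ) + 1)) / ((2 * k + 2) * (2 * k + 1))) / t ^ 3) -
        ∫ t in (1 : ℝ)..x, psiOne t / t ^ 3 := by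
  have hx0 : 0 < x := by linarith
  have hI : Set.uIcc (1 : ℝ) x = Set.Icc 1 x := Set.uIcc_of_le hx
  have hpos : ∀ t ∈ Set.uIcc (1 : ℝ) x, 0 < t := fun t ht ↦ by rw [hI] at ht; linarith [ht.1]
  -- integrability of the four pieces
  have i1 : IntervalIntegrable (fun t : ℝ ↦ 1 / (2 * t)) volume 1 x :=
    (ContinuousOn.div (by fun_prop) (by fun_prop) fun t ht ↦ by have := hpos t ht; positivity).intervalIntegrable
  have i2 : IntervalIntegrable (fun t : ℝ ↦ Real.log (2 * π) * (t ^ 2)⁻¹) volume 1 x :=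
    (ContinuousOn.mul (by fun_prop) (ContinuousOn.inv₀ (by fun_prop) fun t ht ↦ by
      have := hpos t ht; positivity)).intervalIntegrable
  have i3 : IntervalIntegrable (fun t : ℝ ↦
      (∑' k : ℕ, t ^ (-(2 * (k : ℝ) + 1)) / ((2 * k + 2) * (2 * k + 1))) / t ^ 3) volume 1 x := by
    refine (ContinuousOn.div ?_ (by fun_prop) fun t ht ↦ by have := hpos t ht; positivity).intervalIntegrable
    rw [hI]
    exact continuousOn_trivSum.mono fun t ht ↦ Set.mem_Ici.2 ht.1
  have i4 : IntervalIntegrable (fun t : ℝ ↦ psiOne t / t ^ 3) volume 1 x := by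
    refine (ContinuousOn.div ?_ (by fun_prop) fun t ht ↦ by have := hpos t ht; positivity).intervalIntegrable
    rw [hI]
    exact (continuousOn_psiOne x).mono fun t ht ↦ ⟨zero_le_one.trans ht.1, ht.2⟩
  have hcongr : ∫ t in (1 : ℝ)..x, (t ^ 2 / 2 - t * Real.log (2 * π) -
        (∑' k : ℕ, t ^ (-(2 * (k : ℝ) + 1)) / ((2 * k + 2) * (2 * k + 1))) - psiOne t) / t ^ 3 =
      ∫ t in (1 : ℝ)..x, (1 / (2 * t) - Real.log (2 * π) * (t ^ 2)⁻¹ -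
        (∑' k : ℕ, t ^ (-(2 * (k : ℝ) + 1)) / ((2 * k + 2) * (2 * k + 1))) / t ^ 3 - psiOne t / t ^ 3) := by
    refine intervalIntegral.integral_congr fun t ht ↦ ?_
    have ht0 : t ≠ 0 := (hpos t ht).ne'
    show _ / t ^ 3 = _
    field_simp
  rw [hcongr, intervalIntegral.integral_sub ((i1.sub i2).sub i3) i4, intervalIntegral.integral_sub (i1.sub i2) i3,
    intervalIntegral.integral_sub i1 i2, integral_half_inv hx0, intervalIntegral.integral_const_mul,
    integral_inv_sq hx0]

/-- The complex integral of step I in closed form: `∫_1^x P(t) t⁻³ dt = ∫_1^x R(t)t⁻³ dt + (ζ'/ζ)(−1)·(1 − x⁻²)/2`. -/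
lemma integral_pDiv {x : ℝ} (hx : 1 ≤ x) :
    ∫ t in (1 : ℝ)..x, (∑' ρ : ZetaZeros.riemannZetaNontrivialZeros,
        (riemannZetaZeroOrder (ρ : ℂ) : ℂ) * ((t : ℂ) ^ ((ρ : ℂ) + 1) / ((ρ : ℂ) * (ρ + 1)))) / (t : ℂ) ^ 3 =
      ((∫ t in (1 : ℝ)..x, (t ^ 2 / 2 - t * Real.log (2 * π) -
        (∑' k : ℕ, t ^ (-(2 * (k : ℝ) + 1)) / ((2 * k + 2) * (2 * k + 1))) - psiOne t) / t ^ 3 : ℝ) : ℂ) +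
      deriv riemannZeta (-1) / riemannZeta (-1) * (((1 - 1 / x ^ 2) / 2 : ℝ) : ℂ) := by
  have hx0 : 0 < x := by linarith
  have hI : Set.uIcc (1 : ℝ) x = Set.Icc 1 x := Set.uIcc_of_le hx
  have hcongr : ∫ t in (1 : ℝ)..x, (∑' ρ : ZetaZeros.riemannZetaNontrivialZeros,
        (riemannZetaZeroOrder (ρ : ℂ) : ℂ) * ((t : ℂ) ^ ((ρ : ℂ) + 1) / ((ρ : ℂ) * (ρ + 1)))) / (t : ℂ) ^ 3 =
      ∫ t in (1 : ℝ)..x, ((((t ^ 2 / 2 - t * Real.log (2 * π) -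
        (∑' k : ℕ, t ^ (-(2 * (k : ℝ) + 1)) / ((2 * k + 2) * (2 * k + 1))) - psiOne t) / t ^ 3 : ℝ) : ℂ) +
        deriv riemannZeta (-1) / riemannZeta (-1) * (((t ^ 3)⁻¹ : ℝ) : ℂ)) := by
    refine intervalIntegral.integral_congr fun t ht ↦ ?_
    rw [hI] at ht
    have ht0 : (t : ℂ) ≠ 0 := Complex.ofReal_ne_zero.2 (by linarith [ht.1])
    show _ / (t : ℂ) ^ 3 = _
    rw [pSum_eq ht.1]
    push_cast
    field_simp
  have i1 : IntervalIntegrable (fun t : ℝ ↦ ((((t ^ 2 / 2 - t * Real.log (2 * π) -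
      (∑' k : ℕ, t ^ (-(2 * (k : ℝ) + 1)) / ((2 * k + 2) * (2 * k + 1))) - psiOne t) / t ^ 3 : ℝ) : ℂ)))
      volume 1 x := by
    refine ContinuousOn.intervalIntegrable ?_
    rw [hI]
    exact Complex.continuous_ofReal.comp_continuousOn (continuousOn_rDiv x)
  have i2 : IntervalIntegrable (fun t : ℝ ↦ deriv riemannZeta (-1) / riemannZeta (-1) * (((t ^ 3)⁻¹ : ℝ) : ℂ))
      volume 1 x := by
    refine ContinuousOn.intervalIntegrable ?_
    rw [hI]
    refine continuousOn_const.mul (Complex.continuous_ofReal.comp_continuousOn ?_)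
    refine ContinuousOn.inv₀ (by fun_prop) fun t ht ↦ ?_
    have : 0 < t := by linarith [ht.1]
    positivity
  rw [hcongr, intervalIntegral.integral_add i1 i2, intervalIntegral.integral_ofReal,
    intervalIntegral.integral_const_mul, intervalIntegral.integral_ofReal, integral_inv_cube hx0]

/-- **THE EXACT EXPLICIT FORMULA FOR `Φ(x) = Σ_ρ m_ρ x^ρ/(ρ(1−ρ))` (RH-FREE), every real `x ≥ 1`:**
`Φ(x) = (1+γ)x − x log x − log 2π + Σ_{n ≤ x} Λ(n)(x/n − 1) + Σ_{k≥0} x^{−(2k+2)}/((2k+2)(2k+3))`. -/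
theorem phi_eq_real {x : ℝ} (hx : 1 ≤ x) :
    (∑' ρ : ZetaZeros.riemannZetaNontrivialZeros,
      (riemannZetaZeroOrder (ρ : ℂ) : ℂ) * (x : ℂ) ^ (ρ : ℂ) / ((ρ : ℂ) * (1 - (ρ : ℂ)))) =
      (((1 + Real.eulerMascheroniConstant) * x - x * Real.log x - Real.log (2 * π) +
        (∑ n ∈ Finset.Ioc 0 ⌊x⌋₊, (ArithmeticFunction.vonMangoldt n : ℝ) * (x / n - 1)) +
        ∑' k : ℕ, x ^ (-(2 * (k : ℝ) + 2)) / ((2 * k + 2) * (2 * k + 3)) : ℝ) : ℂ) := by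
  have hx0 : 0 < x := by linarith
  have hxC : (x : ℂ) ≠ 0 := Complex.ofReal_ne_zero.2 hx0.ne'
  have hT := trivBracket_eq hx
  have hP := psiBracket_eq hx
  rw [phi_eq hx, integral_pDiv hx, integral_rDiv hx, pSum_eq hx, pSum_eq (le_refl (1 : ℝ)), trivSum_one,
    psiOne_eq_zero (le_refl (1 : ℝ)) one_lt_two]
  -- abbreviations for the real atoms
  set L := Real.log (2 * π) with hL
  set Tx := ∑' k : ℕ, x ^ (-(2 * (k : ℝ) + 1)) / ((2 * k + 2) * (2 * k + 1)) with hTx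
  set IT := ∫ t in (1 : ℝ)..x, (∑' k : ℕ, t ^ (-(2 * (k : ℝ) + 1)) / ((2 * k + 2) * (2 * k + 1))) / t ^ 3 with hIT
  set IP := ∫ t in (1 : ℝ)..x, psiOne t / t ^ 3 with hIP
  set V := ∑' k : ℕ, x ^ (-(2 * (k : ℝ) + 2)) / ((2 * k + 2) * (2 * k + 3)) with hV
  set W := ∑ n ∈ Finset.Ioc 0 ⌊x⌋₊, (ArithmeticFunction.vonMangoldt n : ℝ) * (x / n - 1) with hW
  set c₁ : ℂ := deriv riemannZeta (-1) / riemannZeta (-1) with hc₁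
  have hLsplit : L = Real.log 2 + Real.log π := by
    rw [hL, Real.log_mul two_ne_zero Real.pi_pos.ne']
  -- the real identity
  have key : x * ((2 + Real.eulerMascheroniConstant - Real.log π - 2 * Real.log 2) +
        ((1 : ℝ) ^ 2 / 2 - 1 * L - Real.log 2 - 0)) -
      (x ^ 2 / 2 - x * L - Tx - psiOne x) / x -
      2 * x * (Real.log x / 2 - L * (1 - 1 / x) - IT - IP) =
      (1 + Real.eulerMascheroniConstant) * x - x * Real.log x - L + W + V := by
    rw [hLsplit]
    field_simp at hT hP ⊢
    ring_nf at hT hP ⊢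
    linarith [hT, hP]
  have keyC := congrArg (fun r : ℝ ↦ (r : ℂ)) key
  unfold nicolasBeta
  have hc : (x : ℂ) - 1 / (x : ℂ) - 2 * (x : ℂ) * ((1 - 1 / (x : ℂ) ^ 2) / 2) = 0 := by
    field_simp
    ring
  push_cast at keyC ⊢
  linear_combination keyC + c₁ * hc

/-- `Σ_{m ∈ range (n+1)} f m = Σ_{m ∈ (0, n]} f m` when `f 0 = 0`. -/
lemma sum_range_succ_eq_sum_Ioc {f : ℕ → ℝ} (h0 : f 0 = 0) (n : ℕ) :
    ∑ m ∈ Finset.range (n + 1), f m = ∑ m ∈ Finset.Ioc 0 n, f m := by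
  refine (Finset.sum_subset (fun m hm ↦ ?_) fun m hm hm' ↦ ?_).symm
  · rw [Finset.mem_Ioc] at hm
    exact Finset.mem_range.2 (by omega)
  · rw [Finset.mem_range] at hm
    rw [Finset.mem_Ioc] at hm'
    have : m = 0 := by omega
    rw [this, h0]

end DilateExplicit

open DilateExplicit

/-- **THE DILATE ZERO SUMS ARE PRIME SUMS (RH-FREE; theory target T7, second conjunct):** for every integer `n ≥ 2`,
`S(n) = Σ_ρ m_ρ n^{−ρ}/(ρ(1−ρ)) = nbDilatePrimeSide n
 = (Σ_{m≤n} Λ(m)/m − log n + γ) − (ψ(n) − n)/n + (1 − log 2π)/n − (1/2n) log(1 − n⁻²) − ½ log((n+1)/(n−1))`. -/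
theorem nbDilateZeroSum_eq_nbDilatePrimeSide {n : ℕ} (hn : 2 ≤ n) :
    nbDilateZeroSum n = ((nbDilatePrimeSide n : ℝ) : ℂ) := by
  have hn1 : (1 : ℝ) < n := by exact_mod_cast (show 1 < n by omega)
  have hn0 : (0 : ℝ) < n := by linarith
  rw [nbDilateZeroSum_eq_tsum_div (by omega : 1 ≤ n)]
  rw [show ((n : ℕ) : ℂ) = ((n : ℝ) : ℂ) from (Complex.ofReal_natCast n).symm, phi_eq_real hn1.le,
    (hasSum_evenSeries_closed hn1).tsum_eq, Nat.floor_natCast, ← Complex.ofReal_div]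
  congr 1
  unfold nbDilatePrimeSide
  rw [sum_range_succ_eq_sum_Ioc (by simp) n, sum_range_succ_eq_sum_Ioc (by simp) n]
  have hW : ∑ m ∈ Finset.Ioc 0 n, (ArithmeticFunction.vonMangoldt m : ℝ) * ((n : ℝ) / m - 1) =
      (n : ℝ) * ∑ m ∈ Finset.Ioc 0 n, (ArithmeticFunction.vonMangoldt m : ℝ) / m -
        ∑ m ∈ Finset.Ioc 0 n, (ArithmeticFunction.vonMangoldt m : ℝ) := by
    rw [Finset.mul_sum, ← Finset.sum_sub_distrib]
    exact Finset.sum_congr rfl fun m _ ↦ by ring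
  rw [hW]
  field_simp
  ring

/-- **Theory target (T7) `NbDilateZeroSumExplicit`, both conjuncts (RH-FREE, DISCHARGED):**
`S(1) = 2 + γ − log 4π` and `S(n) = nbDilatePrimeSide n` for every `n ≥ 2`. -/
theorem nbDilateZeroSumExplicit_holds :
    nbDilateZeroSum 1 = ((2 + Real.eulerMascheroniConstant - Real.log (4 * Real.pi) : ℝ) : ℂ) ∧
      ∀ n : ℕ, 2 ≤ n → nbDilateZeroSum n = ((nbDilatePrimeSide n : ℝ) : ℂ) :=
  ⟨nbDilateZeroSum_one, fun _ hn ↦ nbDilateZeroSum_eq_nbDilatePrimeSide hn⟩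

end Summit.RiemannHypothesis.RiemannHypothesis.Theorems.NbTheory

end
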